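import Summits.CriticalPhenomena.PercolationContinuityZ3.Theorems.Transplant.PlanarCells2EfarN2T
import Summits.CriticalPhenomena.PercolationContinuityZ3.Theorems.Transplant.PlanarCells2FaceRows2
import HarnessLib

/-!
(R-40) SUCCESSOR `…T` (hp-8 g42, 2026-08-23; ruling p3-g16 06:23:56Z, J18): the twin of `PlanarCells2FaceRowsS` over the PER-AXIS creep cap `PCells2T` (PlanarCells2TDefs:
`c i ≤ r (oth i)` instead of the uniform `c i ≤ cmax ≤ r j`); statements and proofs VERBATIM with `PCells2S ↦ PCells2T` (+ the renames of record of the T layer below it);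
the only mathematical touch points are the places that read the cap, which only ever need the cross form `c (oth j) ≤ r j` (listed in the lane line of this file's landing).
NO landed file is edited; `PlanarCells2FaceRowsS` stays valid (and is an instance of this file through `PCells2S.toT`). NON-VACUITY: inherited verbatim from `PlanarCells2FaceRowsS` (same witness line).

# STAGGERED two-unit planar cells `PCells2T`: THE FRESH ROWS OF RECORD above the stub of level `j`, in two blocks like the far region they live in —
# `farANSm x du j m := (rows lo_j+1 … 15r∥−1 about cenS x, across 5r⊥−1−m−c) ∪ QNS x du (m+1)`, the shrunk `farASSm` (rows lo_j+2 … 15r∥ about cenS x,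
# across 5r⊥−2−m−c, ∪ rows 15r∥+1 … 25r∥−1 about cenS (x+du), across 5r⊥−2−m); `farANS/farASS` (m = 0) and `farANS₂/farASS₂` (m = 1, hp-8 g33's twins)

WAVE-1 Geom re-base (typer p3-g15; design of record R-30): under (R-27)/(R-29) the one-box fresh rows `farAN/farAS` do not lie in the far region of record,
so they are re-cut in two blocks; the junction is placed so that the 1-thickening of `farASSm` lies in `farANSm ⊆ FarNS/FarNS₂` (across room `c` at
levels `15r∥, 15r∥+1`) and the `k`-enlarged shifted face row lies in `farASSm` under the NEW slot row `k + 3 + m + c ≤ 3 r⊥`.  `M (x+du)` lies in the far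
block for every `j`; separations from `Stub_j` need `j < K`.  Statements in explicit-application form `PCells2T.X P …`.
builds on p205010 (kernel theorem, internal audit signed; external expert review pending) — nothing here uses p205010 or claims anything about the open node.
Lane `prim-bschramm`, seat `prim-bschramm-p3` (gen 15; N2 design owner); definitions file (review lane), `--supports stmt-CriticalPhenomena-4575`.
[cite: KozmaNitzan2024, §4 p. 26 (E_{v,x}), p. 30 (the rows above H^j, F^{j+1})] [folklore]
-/


noncomputable section

namespace Summit.CriticalPhenomena.PercolationContinuityZ3.Theorems.Transplant

open Literature.Probability.Percolation Literature.Probability.LatticeModels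
open Literature.Probability.Percolation.KozmaNitzan
open Literature.Probability.Percolation.KozmaNitzan.Cells (oth oth_ne sgOf sgOf_sign stepVec_apply_fst stepVec_apply_oth eq_oth_of_ne oth_oth)
open PlanarSkeleton (SepInf)
open PCells (mem_psBox_iff sepInf_of_gap)

namespace PCells2T

variable (P : PCells2T)

/-! ## §1 Definitions -/

/-- The lower level of the rows above the stub of level `j`: `lo_j = 5r∥ + 10 s∥ j`. [folklore] -/
def loLev (a : Fin 2) (j : ℕ) : ℤ := 5 * (P.r a : ℤ) + 10 * (P.s a : ℤ) * j

/-- **The fresh rows of record above the stub of level `j`, narrowed by `m`**: between block about `cenS x` (levels `lo_j+1 … 15r∥−1`, across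
`5r⊥ − 1 − m − c`) ∪ the neighbour's block `QNS x du (m+1)`. [cite: KozmaNitzan2024, §4 p. 30] -/
def farANSm (x : Site 2) (du : MDir) (j m : ℕ) : Finset (Site 2) :=
  sBox du.1 (sgOf du) (P.cenS x) (P.loLev du.1 j + 1) (15 * P.r du.1 - 1) (5 * (P.r (oth du.1) : ℤ) - 1 - m - P.c du.1) ∪ P.QNS x du (m + 1)

/-- **The shrunk fresh rows of record** (one unit inside `farANSm` for the planar 1-thickening): between block levels `lo_j+2 … 15r∥` about `cenS x`,
across `5r⊥ − 2 − m − c`; far block levels `15r∥+1 … 25r∥−1` (i.e. `−5r∥+1 … 5r∥−1` from `cenS (x+du)`), across `5r⊥ − 2 − m` about `cenS (x+du)`.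
[cite: KozmaNitzan2024, §4 p. 30] -/
def farASSm (x : Site 2) (du : MDir) (j m : ℕ) : Finset (Site 2) :=
  sBox du.1 (sgOf du) (P.cenS x) (P.loLev du.1 j + 2) (15 * P.r du.1) (5 * (P.r (oth du.1) : ℤ) - 2 - m - P.c du.1) ∪
    sBox du.1 (sgOf du) (P.cenS (x + stepVec du)) (-(5 * (P.r du.1 : ℤ)) + 1) (5 * (P.r du.1 : ℤ) - 1) (5 * (P.r (oth du.1) : ℤ) - 2 - m)

/-- The fresh rows of record (`m = 0`; twin of `farAN`). [cite: KozmaNitzan2024, §4 p. 30] -/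
def farANS (x : Site 2) (du : MDir) (j : ℕ) : Finset (Site 2) := P.farANSm x du j 0

/-- The shrunk fresh rows of record (`m = 0`; twin of `farAS`). [cite: KozmaNitzan2024, §4 p. 30] -/
def farASS (x : Site 2) (du : MDir) (j : ℕ) : Finset (Site 2) := P.farASSm x du j 0

/-- The fresh rows of record one unit in (`m = 1`; twin of `farAN₂`). [cite: KozmaNitzan2024, §4 p. 30] -/
def farANS₂ (x : Site 2) (du : MDir) (j : ℕ) : Finset (Site 2) := P.farANSm x du j 1

/-- The shrunk fresh rows of record one unit in (`m = 1`; twin of `farAS₂`). [cite: KozmaNitzan2024, §4 p. 30] -/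
def farASS₂ (x : Site 2) (du : MDir) (j : ℕ) : Finset (Site 2) := P.farASSm x du j 1

/-! ## §2 The generic facts (`m` arbitrary) -/

/-- Membership in `farANSm`, per block. [folklore] -/
theorem mem_farANSm_iff {x : Site 2} {du : MDir} {j m : ℕ} {t : Site 2} :
    t ∈ PCells2T.farANSm P x du j m ↔
      ((P.loLev du.1 j + 1 ≤ sgOf du * (t du.1 - P.cenS x du.1) ∧ sgOf du * (t du.1 - P.cenS x du.1) ≤ 15 * P.r du.1 - 1) ∧
        P.cenS x (oth du.1) - (5 * (P.r (oth du.1) : ℤ) - 1 - m - P.c du.1) ≤ t (oth du.1) ∧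
        t (oth du.1) ≤ P.cenS x (oth du.1) + (5 * (P.r (oth du.1) : ℤ) - 1 - m - P.c du.1)) ∨
      ((-(5 * (P.r du.1 : ℤ)) ≤ sgOf du * (t du.1 - P.cenS (x + stepVec du) du.1) ∧ sgOf du * (t du.1 - P.cenS (x + stepVec du) du.1) ≤ 5 * P.r du.1) ∧
        P.cenS (x + stepVec du) (oth du.1) - (5 * (P.r (oth du.1) : ℤ) - (m + 1 : ℕ)) ≤ t (oth du.1) ∧
        t (oth du.1) ≤ P.cenS (x + stepVec du) (oth du.1) + (5 * (P.r (oth du.1) : ℤ) - (m + 1 : ℕ))) := by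
  rw [farANSm, Finset.mem_union, mem_QNS_iff, mem_psBox_iff]

/-- Membership in `farASSm`, per block. [folklore] -/
theorem mem_farASSm_iff {x : Site 2} {du : MDir} {j m : ℕ} {t : Site 2} :
    t ∈ PCells2T.farASSm P x du j m ↔
      ((P.loLev du.1 j + 2 ≤ sgOf du * (t du.1 - P.cenS x du.1) ∧ sgOf du * (t du.1 - P.cenS x du.1) ≤ 15 * P.r du.1) ∧
        P.cenS x (oth du.1) - (5 * (P.r (oth du.1) : ℤ) - 2 - m - P.c du.1) ≤ t (oth du.1) ∧
        t (oth du.1) ≤ P.cenS x (oth du.1) + (5 * (P.r (oth du.1) : ℤ) - 2 - m - P.c du.1)) ∨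
      ((-(5 * (P.r du.1 : ℤ)) + 1 ≤ sgOf du * (t du.1 - P.cenS (x + stepVec du) du.1) ∧
          sgOf du * (t du.1 - P.cenS (x + stepVec du) du.1) ≤ 5 * (P.r du.1 : ℤ) - 1) ∧
        P.cenS (x + stepVec du) (oth du.1) - (5 * (P.r (oth du.1) : ℤ) - 2 - m) ≤ t (oth du.1) ∧
        t (oth du.1) ≤ P.cenS (x + stepVec du) (oth du.1) + (5 * (P.r (oth du.1) : ℤ) - 2 - m)) := by
  rw [farASSm, Finset.mem_union]
  exact or_congr mem_psBox_iff mem_psBox_iff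

/-- `farANSm m ⊆ FarNS` for `m = 0` and `⊆ FarNS₂` for `m = 1`: the general monotone form. [folklore] -/
theorem farANSm_subset (x : Site 2) (du : MDir) (j m : ℕ) :
    PCells2T.farANSm P x du j m ⊆ sBox du.1 (sgOf du) (P.cenS x) (5 * P.r du.1 + 1) (15 * P.r du.1 - 1) (5 * (P.r (oth du.1) : ℤ) - 1 - m - P.c du.1)
      ∪ P.QNS x du (m + 1) := by
  refine Finset.union_subset_union ?_ subset_rfl
  refine sBox_mono (sgOf_sign du) _ ?_ le_rfl le_rfl
  unfold loLev; have : (0 : ℤ) ≤ 10 * (P.s du.1 : ℤ) * j := by positivity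
  omega

/-- `farANS ⊆ FarNS`. [folklore] -/
theorem farANS_subset_FarNS (x : Site 2) (du : MDir) (j : ℕ) : PCells2T.farANS P x du j ⊆ PCells2T.FarNS P x du := by
  refine (P.farANSm_subset x du j 0).trans (Finset.union_subset_union ?_ subset_rfl)
  intro t ht; rw [mem_psBox_iff] at ht; rw [mem_BtwNS_iff]; push_cast at ht; exact ⟨ht.1, by omega, by omega⟩

/-- `farANS₂ ⊆ FarNS₂`. [folklore] -/
theorem farANS₂_subset_FarNS₂ (x : Site 2) (du : MDir) (j : ℕ) : PCells2T.farANS₂ P x du j ⊆ PCells2T.FarNS₂ P x du := by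
  refine (P.farANSm_subset x du j 1).trans (Finset.union_subset_union ?_ subset_rfl)
  intro t ht; rw [mem_psBox_iff] at ht; rw [mem_BtwNS₂_iff]; push_cast at ht; exact ⟨ht.1, by omega, by omega⟩

/-- `farANSm` is antitone in `m`. [folklore] -/
theorem farANSm_mono (x : Site 2) (du : MDir) (j : ℕ) {m m' : ℕ} (h : m ≤ m') : PCells2T.farANSm P x du j m' ⊆ PCells2T.farANSm P x du j m := by
  have hm : (m : ℤ) ≤ m' := by exact_mod_cast h
  exact Finset.union_subset_union (sBox_mono (sgOf_sign du) _ le_rfl le_rfl (by omega)) (QNS_mono x du (by omega))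

/-- `farASSm` is antitone in `m`. [folklore] -/
theorem farASSm_mono (x : Site 2) (du : MDir) (j : ℕ) {m m' : ℕ} (h : m ≤ m') : PCells2T.farASSm P x du j m' ⊆ PCells2T.farASSm P x du j m := by
  have hm : (m : ℤ) ≤ m' := by exact_mod_cast h
  exact Finset.union_subset_union (sBox_mono (sgOf_sign du) _ le_rfl le_rfl (by omega)) (sBox_mono (sgOf_sign du) _ le_rfl le_rfl (by omega))

/-- **The planar 1-thickening of `farASSm` lies in `farANSm`** (the junction: a between-block point at level `≥ 15r∥ − 1` whose neighbour rises to
level `15r∥` or `15r∥+1` lands in the neighbour's block, with across room `c`). [folklore] -/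
theorem mem_farANSm_of_near_farASSm {x : Site 2} {du : MDir} {j m : ℕ} {t t' : Site 2} (ht : t ∈ PCells2T.farASSm P x du j m)
    (h : ∀ i, |t' i - t i| ≤ 1) : t' ∈ PCells2T.farANSm P x du j m := by
  have h1 := abs_le.1 (h du.1)
  have h2 := abs_le.1 (h (oth du.1))
  have hf := P.cenS_add_stepVec_fst x du
  have ho := P.cenS_add_stepVec_oth x du
  have hc := P.c_nonneg du.1
  have hr := P.one_le_r du.1
  have hgc : sgOf du * P.c du.1 ≤ P.c du.1 ∧ -P.c du.1 ≤ sgOf du * P.c du.1 := by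
    rcases sgOf_sign du with hs | hs <;> rw [hs] <;> constructor <;> linarith
  rw [mem_farANSm_iff, hf, ho]
  rw [mem_farASSm_iff, hf, ho] at ht
  push_cast
  by_cases hlev : sgOf du * (t' du.1 - P.cenS x du.1) ≤ 15 * P.r du.1 - 1
  · left
    rcases ht with ⟨⟨ha1, ha2⟩, ha3, ha4⟩ | ⟨⟨hb1, hb2⟩, hb3, hb4⟩
    · refine ⟨⟨?_, hlev⟩, by omega, by omega⟩
      rcases sgOf_sign du with hs | hs <;> rw [hs] at ha1 ⊢ <;> omega
    · exfalso; rcases sgOf_sign du with hs | hs <;> rw [hs] at hb1 hlev <;> omega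
  · right
    rcases ht with ⟨⟨ha1, ha2⟩, ha3, ha4⟩ | ⟨⟨hb1, hb2⟩, hb3, hb4⟩
    · refine ⟨?_, by omega, by omega⟩
      rcases sgOf_sign du with hs | hs <;> rw [hs] at ha1 ha2 hlev ⊢ <;> constructor <;> omega
    · refine ⟨?_, by omega, by omega⟩
      rcases sgOf_sign du with hs | hs <;> rw [hs] at hb1 hb2 hlev ⊢ <;> constructor <;> omega

/-- `farASSm ⊆ farANSm` (the `0`-thickening). [folklore] -/
theorem farASSm_subset_farANSm (x : Site 2) (du : MDir) (j m : ℕ) : PCells2T.farASSm P x du j m ⊆ PCells2T.farANSm P x du j m :=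
  fun t ht => P.mem_farANSm_of_near_farASSm ht fun i => by simp

/-- **Level and across bounds of a point of `farASSm`**, per block. [folklore] -/
theorem bounds_of_mem_farASSm {x : Site 2} {du : MDir} {j m : ℕ} {t : Site 2} (ht : t ∈ PCells2T.farASSm P x du j m) :
    (P.loLev du.1 j + 2 ≤ PCells2T.lev P du x t ∨ 15 * (P.r du.1 : ℤ) + 1 ≤ PCells2T.lev P du x t) ∧
    PCells2T.lev P du x t ≤ 25 * P.r du.1 - 1 ∧
    (PCells2T.lev P du x t ≤ 15 * P.r du.1 → |t (oth du.1) - PCells2T.cenS P x (oth du.1)| ≤ 5 * P.r (oth du.1) - 2 - m - P.c du.1) ∧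
    (15 * (P.r du.1 : ℤ) + 1 ≤ PCells2T.lev P du x t →
      |t (oth du.1) - PCells2T.cenS P (x + stepVec du) (oth du.1)| ≤ 5 * P.r (oth du.1) - 2 - m) := by
  rw [mem_farASSm_iff, P.cenS_add_stepVec_fst] at ht
  unfold lev
  have hr := P.one_le_r du.1
  have hK := P.s_mul_le_r (i := du.1) le_rfl
  rcases ht with ⟨⟨ha1, ha2⟩, ha3, ha4⟩ | ⟨⟨hb1, hb2⟩, hb3, hb4⟩
  · refine ⟨Or.inl ha1, ?_, fun _ => abs_le.2 ⟨by omega, by omega⟩, fun h => by omega⟩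
    unfold loLev at ha1; nlinarith
  · refine ⟨Or.inr ?_, ?_, fun h => ?_, fun _ => abs_le.2 ⟨by omega, by omega⟩⟩
    · rcases sgOf_sign du with hs | hs <;> rw [hs] at hb1 ⊢ <;> nlinarith
    · rcases sgOf_sign du with hs | hs <;> rw [hs] at hb2 ⊢ <;> nlinarith
    · exfalso; rcases sgOf_sign du with hs | hs <;> rw [hs] at hb1 h <;> nlinarith

/-- Membership in `farASSm` from BETWEEN-block bounds (level in `[lo_j+2, 15r∥]`, across `≤ 5r⊥ − 2 − m − c` about `cenS x`). [folklore] -/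
theorem mem_farASSm_of_bounds_near {x : Site 2} {du : MDir} {j m : ℕ} {t : Site 2} (h1 : P.loLev du.1 j + 2 ≤ PCells2T.lev P du x t)
    (h2 : PCells2T.lev P du x t ≤ 15 * P.r du.1) (h3 : |t (oth du.1) - PCells2T.cenS P x (oth du.1)| ≤ 5 * P.r (oth du.1) - 2 - m - P.c du.1) :
    t ∈ PCells2T.farASSm P x du j m := by
  rw [mem_farASSm_iff]
  unfold lev at h1 h2
  have := abs_le.1 h3
  exact Or.inl ⟨⟨h1, h2⟩, by omega, by omega⟩

/-- Membership in `farASSm` from FAR-block bounds (level in `[15r∥+1, 25r∥−1]`, across `≤ 5r⊥ − 2 − m` about `cenS (x+du)`). [folklore] -/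
theorem mem_farASSm_of_bounds_far {x : Site 2} {du : MDir} {j m : ℕ} {t : Site 2} (h1 : 15 * (P.r du.1 : ℤ) + 1 ≤ PCells2T.lev P du x t)
    (h2 : PCells2T.lev P du x t ≤ 25 * P.r du.1 - 1)
    (h3 : |t (oth du.1) - PCells2T.cenS P (x + stepVec du) (oth du.1)| ≤ 5 * P.r (oth du.1) - 2 - m) : t ∈ PCells2T.farASSm P x du j m := by
  rw [mem_farASSm_iff, P.cenS_add_stepVec_fst]
  unfold lev at h1 h2
  have := abs_le.1 h3
  right
  refine ⟨?_, by omega, by omega⟩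
  rcases sgOf_sign du with hs | hs <;> rw [hs] at h1 h2 ⊢ <;> constructor <;> nlinarith

/-- **`M (x+du) ⊆ farASSm x du j m`** for every `j` and `m ≤ 2r⊥ − 2` (the cube sits in the far block: levels `[17r∥, 23r∥]`, across `3r⊥`).
[cite: KozmaNitzan2024, §4 p. 26 (M_x)] -/
theorem M_add_stepVec_subset_farASSm (x : Site 2) (du : MDir) (j : ℕ) {m : ℕ} (hm : (m : ℤ) + 2 ≤ 2 * P.r (oth du.1)) :
    PCells2T.M P (x + stepVec du) ⊆ PCells2T.farASSm P x du j m := by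
  intro t ht
  have hl1 := P.lev_ge_of_mem_M_add (δ := du) ht
  have hl2 := P.lev_le_of_mem_M_add (δ := du) ht
  rw [M, mem_aboxS_iff] at ht
  have h := ht (oth du.1); push_cast at h
  have hr := P.one_le_r du.1
  exact P.mem_farASSm_of_bounds_far (by omega) (by omega) (abs_le.2 ⟨by omega, by omega⟩)

/-- **The `k`-enlarged shifted face row lies in `farASSm x du j m`** when `j + 1 ≤ K`, `k + 3 ≤ 10 s∥` and — the slot row of the staggered cells —
`k + 3 + m + c ≤ 3 r⊥` (levels `≤ 15r∥` land in the between block, the overflow `15r∥+1 … 15r∥−1+k` of the top row in the neighbour's block).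
[cite: KozmaNitzan2024, §4 p. 30 (the levels above F^{j+1})] -/
theorem faceRow_enlarge_subset_farASSm (x : Site 2) (du : MDir) {j k m : ℕ} (hj : j + 1 ≤ P.K) (hk : k + 3 ≤ 10 * P.s du.1)
    (hk' : (k : ℤ) + 3 + m + P.c du.1 ≤ 3 * P.r (oth du.1)) :
    Finset.Icc (P.faceLo x du j - (k : Site 2)) (P.faceHi x du j + (k : Site 2)) ⊆ PCells2T.farASSm P x du j m := by
  rw [faceLo, faceHi, sBox_enlarge _ _ (sgOf_sign du)]
  intro t ht
  rw [mem_psBox_iff] at ht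
  obtain ⟨⟨h1, h2⟩, h3, h4⟩ := ht
  have hsj : (P.s du.1 : ℤ) * (j + 1) ≤ P.r du.1 := by
    have h := Nat.mul_le_mul_left (P.s du.1) hj
    rw [Nat.mul_comm (P.s du.1) P.K] at h
    exact_mod_cast (show P.s du.1 * (j + 1) ≤ P.r du.1 from h)
  have h20 := P.twenty_mul_s_le_r du.1
  have hkz : (k : ℤ) + 3 ≤ 10 * P.s du.1 := by exact_mod_cast hk
  have hc := P.c_nonneg du.1
  have hgc : sgOf du * P.c du.1 ≤ P.c du.1 ∧ -P.c du.1 ≤ sgOf du * P.c du.1 := by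
    rcases sgOf_sign du with hs | hs <;> rw [hs] <;> constructor <;> linarith
  have ho := P.cenS_add_stepVec_oth x du
  rw [PCells2.faceL_eq] at h1 h2
  by_cases hlev : sgOf du * (t du.1 - P.cenS x du.1) ≤ 15 * P.r du.1
  · refine P.mem_farASSm_of_bounds_near ?_ hlev (abs_le.2 ⟨by omega, by omega⟩)
    unfold lev loLev; nlinarith
  · refine P.mem_farASSm_of_bounds_far (by unfold lev; omega) ?_ ?_
    · unfold lev; nlinarith
    · rw [ho]; exact abs_le.2 ⟨by omega, by omega⟩

/-- The shifted face row itself lies in `farASSm` (`k = 0`). [cite: KozmaNitzan2024, §4 p. 30] -/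
theorem faceRow_subset_farASSm (x : Site 2) (du : MDir) {j m : ℕ} (hj : j + 1 ≤ P.K) (hm : (m : ℤ) + 3 + P.c du.1 ≤ 3 * P.r (oth du.1)) :
    Finset.Icc (P.faceLo x du j) (P.faceHi x du j) ⊆ PCells2T.farASSm P x du j m := by
  have h := P.faceRow_enlarge_subset_farASSm x du (k := 0) (m := m) hj (by have := P.hs du.1; omega) (by push_cast; linarith)
  simpa using h

/-- `Q x` is ℓ^∞-gap separated from `farASSm` (levels `≤ 5r∥` against `≥ 5r∥ + 2`). [cite: KozmaNitzan2024, §4 p. 26 ((29))] -/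
theorem Q_sepInf_farASSm (x : Site 2) (du : MDir) (j m : ℕ) : SepInf (↑(PCells2T.Q P x) : Set (Site 2)) ↑(PCells2T.farASSm P x du j m) := by
  intro y hy z hz
  have h1 : PCells2T.lev P du x y ≤ 5 * P.r du.1 := P.lev_le_of_mem_Q (Finset.mem_coe.1 hy)
  have h2 := (P.bounds_of_mem_farASSm (Finset.mem_coe.1 hz)).1
  have hr := P.one_le_r du.1
  unfold loLev at h2; unfold lev at h1 h2
  have : (0 : ℤ) ≤ 10 * (P.s du.1 : ℤ) * j := by positivity
  refine sepInf_of_gap du.1 ?_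
  rcases sgOf_sign du with hs | hs <;> rw [hs] at h1 h2 <;> omega

/-- The stub `H^j` is ℓ^∞-gap separated from `farASSm x du j m` for `j < K` (between block: levels `≥ lo_j + 2`; far block: `≥ 15r∥+1 ≥ lo_j + 10s∥ + 1`).
[cite: KozmaNitzan2024, §4 p. 30] -/
theorem Stub_sepInf_farASSm (x : Site 2) (du : MDir) {j : ℕ} (hj : j < P.K) (m : ℕ) :
    SepInf (↑(PCells2T.Stub P x du j) : Set (Site 2)) ↑(PCells2T.farASSm P x du j m) := by
  intro y hy z hz
  have h1 := (P.lev_mem_of_mem_Stub (Finset.mem_coe.1 hy)).2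
  have h2 := (P.bounds_of_mem_farASSm (Finset.mem_coe.1 hz)).1
  have hsj := PCells2.ten_s_mul_le_of_lt P.toPCells2 (a := du.1) hj
  have hs1 := P.hs du.1
  unfold loLev at h2; unfold lev at h1 h2
  refine sepInf_of_gap du.1 ?_
  rcases sgOf_sign du with hs | hs <;> rw [hs] at h1 h2 <;> omega

/-- `farANSm x du j m ∩ Stub_j = ∅` for `j < K`. [folklore] -/
theorem farANSm_disjoint_Stub (x : Site 2) (du : MDir) {j : ℕ} (hj : j < P.K) (m : ℕ) :
    Disjoint (PCells2T.farANSm P x du j m) (PCells2T.Stub P x du j) := by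
  rw [Finset.disjoint_left]
  intro t ht ht'
  rw [mem_farANSm_iff, P.cenS_add_stepVec_fst] at ht
  rw [Stub, mem_psBox_iff] at ht'
  have hsj := PCells2.ten_s_mul_le_of_lt P.toPCells2 (a := du.1) hj
  have hs1 := P.hs du.1
  unfold loLev at ht
  rcases ht with ⟨⟨h1, -⟩, -⟩ | ⟨⟨h1, -⟩, -⟩
  · omega
  · rcases sgOf_sign du with hs | hs <;> rw [hs] at h1 ht' <;> nlinarith [ht'.1.2]

/-! ## §3 The statements the face column reads (`m = 1`: `farANS₂/farASS₂`; `m = 0`: `farANS/farASS`) -/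

/-- `farASS₂ ⊆ farANS₂`. [folklore] -/
theorem farASS₂_subset_farANS₂ (x : Site 2) (du : MDir) (j : ℕ) : PCells2T.farASS₂ P x du j ⊆ PCells2T.farANS₂ P x du j :=
  P.farASSm_subset_farANSm x du j 1

/-- `farASS₂ ⊆ FarNS₂`. [folklore] -/
theorem farASS₂_subset_FarNS₂ (x : Site 2) (du : MDir) (j : ℕ) : PCells2T.farASS₂ P x du j ⊆ PCells2T.FarNS₂ P x du :=
  (P.farASS₂_subset_farANS₂ x du j).trans (P.farANS₂_subset_FarNS₂ x du j)

/-- `farASS₂ ⊆ farASS`. [folklore] -/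
theorem farASS₂_subset_farASS (x : Site 2) (du : MDir) (j : ℕ) : PCells2T.farASS₂ P x du j ⊆ PCells2T.farASS P x du j :=
  P.farASSm_mono x du j (by norm_num)

/-- `farANS₂ ⊆ farANS`. [folklore] -/
theorem farANS₂_subset_farANS (x : Site 2) (du : MDir) (j : ℕ) : PCells2T.farANS₂ P x du j ⊆ PCells2T.farANS P x du j :=
  P.farANSm_mono x du j (by norm_num)

/-- **The planar 1-thickening of `farASS₂` lies in `farANS₂`.** [folklore] -/
theorem mem_farANS₂_of_near_farASS₂ {x : Site 2} {du : MDir} {j : ℕ} {t t' : Site 2} (ht : t ∈ PCells2T.farASS₂ P x du j)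
    (h : ∀ i, |t' i - t i| ≤ 1) : t' ∈ PCells2T.farANS₂ P x du j :=
  P.mem_farANSm_of_near_farASSm ht h

/-- **The planar 1-thickening of `farASS₂` lies in `FarNS₂`.** [folklore] -/
theorem mem_FarNS₂_of_near_farASS₂ {x : Site 2} {du : MDir} {j : ℕ} {t t' : Site 2} (ht : t ∈ PCells2T.farASS₂ P x du j)
    (h : ∀ i, |t' i - t i| ≤ 1) : t' ∈ PCells2T.FarNS₂ P x du :=
  P.farANS₂_subset_FarNS₂ x du j (P.mem_farANS₂_of_near_farASS₂ ht h)

/-- The planar 1-thickening of `farASS` lies in `FarNS`. [folklore] -/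
theorem mem_FarNS_of_near_farASS {x : Site 2} {du : MDir} {j : ℕ} {t t' : Site 2} (ht : t ∈ PCells2T.farASS P x du j)
    (h : ∀ i, |t' i - t i| ≤ 1) : t' ∈ PCells2T.FarNS P x du :=
  P.farANS_subset_FarNS x du j (P.mem_farANSm_of_near_farASSm ht h)

/-- `farASS ⊆ farANS ⊆ FarNS`. [folklore] -/
theorem farASS_subset_FarNS (x : Site 2) (du : MDir) (j : ℕ) : PCells2T.farASS P x du j ⊆ PCells2T.FarNS P x du :=
  (P.farASSm_subset_farANSm x du j 0).trans (P.farANS_subset_FarNS x du j)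

/-- `M (x+du) ⊆ farASS₂ x du j` (every `j`). [cite: KozmaNitzan2024, §4 p. 26 (M_x)] -/
theorem M_add_stepVec_subset_farASS₂ (x : Site 2) (du : MDir) (j : ℕ) : PCells2T.M P (x + stepVec du) ⊆ PCells2T.farASS₂ P x du j :=
  P.M_add_stepVec_subset_farASSm x du j (by have := P.twenty_mul_s_le_r (oth du.1); have := P.hs (oth du.1); push_cast; omega)

/-- `M (x+du) ⊆ farASS x du j` (every `j`). [cite: KozmaNitzan2024, §4 p. 26 (M_x)] -/
theorem M_add_stepVec_subset_farASS (x : Site 2) (du : MDir) (j : ℕ) : PCells2T.M P (x + stepVec du) ⊆ PCells2T.farASS P x du j :=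
  P.M_add_stepVec_subset_farASSm x du j (by have := P.twenty_mul_s_le_r (oth du.1); have := P.hs (oth du.1); push_cast; omega)

/-- The shifted face row lies in `farASS₂` (`j + 1 ≤ K`; `4 + c ≤ 3r⊥`). [cite: KozmaNitzan2024, §4 p. 30] -/
theorem faceRow_subset_farASS₂ (x : Site 2) (du : MDir) {j : ℕ} (hj : j + 1 ≤ P.K) :
    Finset.Icc (P.faceLo x du j) (P.faceHi x du j) ⊆ PCells2T.farASS₂ P x du j :=
  P.faceRow_subset_farASSm x du hj (by
    have := P.twenty_mul_s_le_r (oth du.1); have := P.hs (oth du.1); have := P.c_le_r_oth du; push_cast; omega)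

/-- **The `k`-enlarged shifted face row lies in `farASS₂`** (`j + 1 ≤ K`, `k + 3 ≤ 10 s∥`, slot row `k + 4 + c ≤ 3 r⊥`). [cite: KozmaNitzan2024, §4 p. 30] -/
theorem faceRow_enlarge_subset_farASS₂ (x : Site 2) (du : MDir) {j k : ℕ} (hj : j + 1 ≤ P.K) (hk : k + 3 ≤ 10 * P.s du.1)
    (hk' : (k : ℤ) + 4 + P.c du.1 ≤ 3 * P.r (oth du.1)) :
    Finset.Icc (P.faceLo x du j - (k : Site 2)) (P.faceHi x du j + (k : Site 2)) ⊆ PCells2T.farASS₂ P x du j :=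
  P.faceRow_enlarge_subset_farASSm x du hj hk (by push_cast; linarith)

/-- Level and across bounds of a point of `farASS₂`, per block. [folklore] -/
theorem bounds_of_mem_farASS₂ {x : Site 2} {du : MDir} {j : ℕ} {t : Site 2} (ht : t ∈ PCells2T.farASS₂ P x du j) :
    (P.loLev du.1 j + 2 ≤ PCells2T.lev P du x t ∨ 15 * (P.r du.1 : ℤ) + 1 ≤ PCells2T.lev P du x t) ∧
    PCells2T.lev P du x t ≤ 25 * P.r du.1 - 1 ∧
    (PCells2T.lev P du x t ≤ 15 * P.r du.1 → |t (oth du.1) - PCells2T.cenS P x (oth du.1)| ≤ 5 * P.r (oth du.1) - 3 - P.c du.1) ∧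
    (15 * (P.r du.1 : ℤ) + 1 ≤ PCells2T.lev P du x t →
      |t (oth du.1) - PCells2T.cenS P (x + stepVec du) (oth du.1)| ≤ 5 * P.r (oth du.1) - 3) := by
  have h := P.bounds_of_mem_farASSm ht
  push_cast at h
  refine ⟨h.1, h.2.1, fun hl => (h.2.2.1 hl).trans (by omega), fun hl => (h.2.2.2 hl).trans (by omega)⟩

/-- Membership in `farASS₂` from between-block bounds. [folklore] -/
theorem mem_farASS₂_of_bounds_near {x : Site 2} {du : MDir} {j : ℕ} {t : Site 2} (h1 : P.loLev du.1 j + 2 ≤ PCells2T.lev P du x t)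
    (h2 : PCells2T.lev P du x t ≤ 15 * P.r du.1) (h3 : |t (oth du.1) - PCells2T.cenS P x (oth du.1)| ≤ 5 * P.r (oth du.1) - 3 - P.c du.1) :
    t ∈ PCells2T.farASS₂ P x du j :=
  P.mem_farASSm_of_bounds_near h1 h2 (h3.trans (by push_cast; omega))

/-- Membership in `farASS₂` from far-block bounds. [folklore] -/
theorem mem_farASS₂_of_bounds_far {x : Site 2} {du : MDir} {j : ℕ} {t : Site 2} (h1 : 15 * (P.r du.1 : ℤ) + 1 ≤ PCells2T.lev P du x t)
    (h2 : PCells2T.lev P du x t ≤ 25 * P.r du.1 - 1)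
    (h3 : |t (oth du.1) - PCells2T.cenS P (x + stepVec du) (oth du.1)| ≤ 5 * P.r (oth du.1) - 3) : t ∈ PCells2T.farASS₂ P x du j :=
  P.mem_farASSm_of_bounds_far h1 h2 (h3.trans (by push_cast; omega))

/-- Points of `farASS₂` have level `≥ 5r∥ + 2`. [folklore] -/
theorem le_lev_of_mem_farASS₂ {x : Site 2} {du : MDir} {j : ℕ} {t : Site 2} (ht : t ∈ PCells2T.farASS₂ P x du j) :
    5 * (P.r du.1 : ℤ) + 2 ≤ PCells2T.lev P du x t := by
  have h := (P.bounds_of_mem_farASSm ht).1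
  have hr := P.one_le_r du.1
  unfold loLev at h; have : (0 : ℤ) ≤ 10 * (P.s du.1 : ℤ) * j := by positivity
  omega

/-- Points of `farASS₂` have level `≤ 25r∥ − 1`. [folklore] -/
theorem lev_le_of_mem_farASS₂ {x : Site 2} {du : MDir} {j : ℕ} {t : Site 2} (ht : t ∈ PCells2T.farASS₂ P x du j) :
    PCells2T.lev P du x t ≤ 25 * P.r du.1 - 1 :=
  (P.bounds_of_mem_farASSm ht).2.1

/-- `Q x` is ℓ^∞-gap separated from `farASS₂`. [cite: KozmaNitzan2024, §4 p. 26 ((29))] -/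
theorem Q_sepInf_farASS₂ (x : Site 2) (du : MDir) (j : ℕ) : SepInf (↑(PCells2T.Q P x) : Set (Site 2)) ↑(PCells2T.farASS₂ P x du j) :=
  P.Q_sepInf_farASSm x du j 1

/-- `Q x` is ℓ^∞-gap separated from `farASS`. [cite: KozmaNitzan2024, §4 p. 26 ((29))] -/
theorem Q_sepInf_farASS (x : Site 2) (du : MDir) (j : ℕ) : SepInf (↑(PCells2T.Q P x) : Set (Site 2)) ↑(PCells2T.farASS P x du j) :=
  P.Q_sepInf_farASSm x du j 0

/-- The stub `H^j` is ℓ^∞-gap separated from `farASS₂` (`j < K`). [cite: KozmaNitzan2024, §4 p. 30] -/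
theorem Stub_sepInf_farASS₂ (x : Site 2) (du : MDir) {j : ℕ} (hj : j < P.K) :
    SepInf (↑(PCells2T.Stub P x du j) : Set (Site 2)) ↑(PCells2T.farASS₂ P x du j) :=
  P.Stub_sepInf_farASSm x du hj 1

/-- `farANS₂ x du j ∩ Stub_j = ∅` (`j < K`). [folklore] -/
theorem farANS₂_disjoint_Stub (x : Site 2) (du : MDir) {j : ℕ} (hj : j < P.K) : Disjoint (PCells2T.farANS₂ P x du j) (PCells2T.Stub P x du j) :=
  P.farANSm_disjoint_Stub x du hj 1

/-- `farANS x du j ∩ Stub_j = ∅` (`j < K`). [folklore] -/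
theorem farANS_disjoint_Stub (x : Site 2) (du : MDir) {j : ℕ} (hj : j < P.K) : Disjoint (PCells2T.farANS P x du j) (PCells2T.Stub P x du j) :=
  P.farANSm_disjoint_Stub x du hj 0

end PCells2T

end Summit.CriticalPhenomena.PercolationContinuityZ3.Theorems.Transplant

end
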